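import Summits.Ventures.LatticeQCDFlow.Scaling.UnitSurvivalFloor
import Summits.Ventures.LatticeQCDFlow.Scaling.FlowStarMixingCeiling
import Summits.Ventures.LatticeQCDFlow.Scaling.DominatedStarGapAndMixing

/-!
HONEST FRAMING: exact (Metropolis-corrected) sampling algorithms for lattice gauge theory; figures
of merit are autocorrelation/cost numbers at stated couplings and volumes; no continuum-physics
claim.

# FlowStarUnitSurvivalFloor — PERFECT FLOWS DO NOT BEAT THE UNIT `m/(t(1−t)ĉ)`: FOR THE MAP-ASSISTED HOT-ONLY HUB WHOSE
# LEVEL MAPS PUSH `μ_0` EXACTLY ONTO EACH COLD LAW, `d(n) ≥ (1 − t(1−t)ĉ/m)ⁿ − (K+1)μ_0(s)` FOR EVERY STATE `s`, HENCE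
# `t_mix(ε) ≥ (m/(t(1−t)ĉ) − 1)·log(1/(ε + (K+1)μ_0(s)))` AND, ON A LARGE CONFIGURATION SPACE AT UNIFORM LISTING,
# `t_mix(1/4) ≥ (K/(t(1−t)) − 1)·log 2` (lean-2 GEN-27, ours)

Venture-side (OURS).  Cell `lqcd-flow` (pub-lqcd), unit `pub-lqcd-lean-2-g27`, 2026-08-27.  Chapter M, the floor side,
file 3.  THE SCHEME is the perfectly transported flow hub of `Scaling/FlowStarMixingCeiling`: hub list
`e_r = (0, κ_r+1)` carrying the LEVEL map `φ_{κ_r}` on each entry, positive laws `μ_0, …, μ_K` with `Σ μ_0 = 1` and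
PERFECT TRANSPORT `μ_{k+1}(φ_k u) = μ_0(u)`, hot-only updates with `μ_k`-reversible row-stochastic single-site kernels
(only `M_0` acts; exactness NOT needed); `P = t·GSw + (1−t)·coordKernel M 0`.  By
`flowStar_worstTvDist_eq` its distance profile is that of the idealised star with the relabelled kernels, to which
`Scaling/UnitSurvivalFloor` applies verbatim (its floor needs the hot kernel row-stochastic only).

## What is proved

* **`flowStar_unitSurvival_worstTvDist_ge`** — `d(n) ≥ (1 − t(1−t)ĉ/m)ⁿ − (K+1)·μ_0(s)` for every `s`
  (multiplicities `≤ ĉ ≤ m`, `K ≥ 1`, `0 ≤ t ≤ 1`).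
* **`flowStar_unitSurvival_mixingTime_ge`** — `0 < t < 1`, `1 ≤ ĉ`, `μ_k`-reversible kernels, `ε`-close at some time:
  `t_mix(ε) ≥ (m/(t(1−t)ĉ) − 1)·log(1/(ε + (K+1)μ_0(s)))`.
* **`flowStar_unitSurvival_mixingTime_ge_quarter_of_card`** — `|S| ≥ 4(K+1)`: `t_mix(1/4) ≥ (m/(t(1−t)ĉ) − 1)·log 2`;
  **`uniformFlowStar_unitSurvival_floor`** — `m = cK`, multiplicities `≤ c`: `t_mix(1/4) ≥ (K/(t(1−t)) − 1)·log 2`.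

Reading (no numerics implied): together with `Scaling/FlowStarMixingCeiling` (`t_mix(ε) ≤ ⌈(2m/(t(1−t)c))·log((K+1)/(tε))⌉`)
the perfectly trained flow hub is pinned in the unit `m/(t(1−t)c)` up to a logarithm: exact transports remove every
rejection but not the product of the hub's capture rate and its refresh odds.  NOT CLAIMED: the `log K` on the
floor; imperfect maps (a rejected or non-transporting swap changes the bookkeeping); anything measured.  Literature
grade (cell rule): OWN RESULT (`Scaling/UnitSurvivalFloor` through the conjugacy of `Scaling/FlowStarMixingCeiling`);
nothing cited as a fact; no new bib keys.
-/

noncomputable section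

open Finset Function
open Literature.Probability.MarkovChains

namespace Summit.Ventures.LatticeQCDFlow.Scaling

variable {S : Type*} [Fintype S] [DecidableEq S] {K m : ℕ} {μ : Fin (K + 1) → S → ℝ} {M : Fin (K + 1) → S → S → ℝ}
  {t : ℝ}

section FlowFloor
variable (κ : Fin m → Fin K) (φ : Fin K → Equiv.Perm S)

/-- **THE UNIT-SURVIVAL DISTANCE FLOOR FOR THE PERFECTLY TRANSPORTED FLOW HUB:
`d(n) ≥ (1 − t(1−t)ĉ/m)ⁿ − (K+1)·μ_0(s)`** for every state `s` (`μ > 0`, `Σ μ_0 = 1`, perfect transport, hot-only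
row-stochastic updates, multiplicities `≤ ĉ ≤ m`, `K ≥ 1`, `0 ≤ t ≤ 1`). [ours] -/
theorem flowStar_unitSurvival_worstTvDist_ge (hK : 1 ≤ K) (hm : 1 ≤ m) (ht0 : 0 ≤ t) (ht1 : t ≤ 1)
    (hμ : ∀ k x, 0 < μ k x) (hμ01 : ∑ v, μ 0 v = 1) (hM : ∀ k, IsRowStochastic (M k))
    (hperf : ∀ (k : Fin K) (u : S), μ k.succ (φ k u) = μ 0 u)
    {cmax : ℕ} (hc : ∀ p' : Fin K, (univ.filter (fun r : Fin m => κ r = p')).card ≤ cmax) (hcm : cmax ≤ m)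
    (s : S) (n : ℕ) :
    (1 - t * (1 - t) * cmax / m) ^ n - ((K : ℝ) + 1) * μ 0 s
      ≤ worstTvDist (fun y z : Fin (K + 1) → S =>
          t * ptGraphSwap μ (fun r : Fin m => ((0 : Fin (K + 1)), (κ r).succ)) (fun r => φ (κ r)) y z
          + (1 - t) * prodKernel (fun k : Fin (K + 1) => if k = 0 then (1 : ℝ) else 0) M y z) (tensorFun μ) n := by
  rw [flowStar_worstTvDist_eq κ φ hμ hperf n]
  exact unitSurvival_worstTvDist_ge κ hK hm ht0 ht1 (fun v => hμ 0 v) hμ01 (relabel_kernels_isRowStochastic φ hM) hc hcm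
    s n

/-- **THE UNIT-SURVIVAL FLOOR ON THE MIXING TIME OF THE PERFECTLY TRANSPORTED FLOW HUB:** `0 < t < 1`, `1 ≤ ĉ ≤ m`,
`μ_k`-reversible kernels, the scheme `ε`-close at some time:
**`t_mix(ε) ≥ (m/(t(1−t)ĉ) − 1)·log(1/(ε + (K+1)μ_0(s)))`** for every `s`. [ours] -/
theorem flowStar_unitSurvival_mixingTime_ge (hK : 1 ≤ K) (hm : 1 ≤ m) (ht0 : 0 < t) (ht1 : t < 1)
    (hμ : ∀ k x, 0 < μ k x) (hμ01 : ∑ v, μ 0 v = 1) (hM : ∀ k, IsRowStochastic (M k))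
    (hMrev : ∀ k, DetailedBalance (μ k) (M k)) (hperf : ∀ (k : Fin K) (u : S), μ k.succ (φ k u) = μ 0 u)
    {cmax : ℕ} (hc1 : 1 ≤ cmax) (hc : ∀ p' : Fin K, (univ.filter (fun r : Fin m => κ r = p')).card ≤ cmax)
    (hcm : cmax ≤ m) (s : S) {ε : ℝ}
    (hmix : ∃ t₀, worstTvDist (fun y z : Fin (K + 1) → S =>
          t * ptGraphSwap μ (fun r : Fin m => ((0 : Fin (K + 1)), (κ r).succ)) (fun r => φ (κ r)) y z
          + (1 - t) * prodKernel (fun k : Fin (K + 1) => if k = 0 then (1 : ℝ) else 0) M y z) (tensorFun μ) t₀ ≤ ε) :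
    ((m : ℝ) / (t * (1 - t) * cmax) - 1) * Real.log (1 / (ε + ((K : ℝ) + 1) * μ 0 s))
      ≤ (mixingTime (fun y z : Fin (K + 1) → S =>
          t * ptGraphSwap μ (fun r : Fin m => ((0 : Fin (K + 1)), (κ r).succ)) (fun r => φ (κ r)) y z
          + (1 - t) * prodKernel (fun k : Fin (K + 1) => if k = 0 then (1 : ℝ) else 0) M y z) (tensorFun μ) ε : ℝ) := by
  have hw0 : ∀ k : Fin (K + 1), 0 ≤ (if k = 0 then (1 : ℝ) else 0) := fun k => by split_ifs <;> norm_num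
  have hw1 : ∑ k : Fin (K + 1), (if k = 0 then (1 : ℝ) else 0) = 1 := by
    rw [Finset.sum_ite_eq' univ (0 : Fin (K + 1)), if_pos (mem_univ _)]
  have hPst := weightedScheme_isRowStochastic (t := t) (w := fun k : Fin (K + 1) => if k = 0 then (1 : ℝ) else 0)
    (ptGraphSwap_isRowStochastic (e := fun r : Fin m => ((0 : Fin (K + 1)), (κ r).succ)) (φ := fun r => φ (κ r)) hμ)
    hM hw0 hw1 ht0.le ht1.le
  have hst := dominatedStar_isStationary κ (fun r => φ (κ r)) (t := t)
    (w := fun k : Fin (K + 1) => if k = 0 then (1 : ℝ) else 0) ht0.le ht1.le hw0 hw1 hμ hM hMrev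
  have hmpos : (0 : ℝ) < m := Nat.cast_pos.mpr (by omega)
  have hcpos : (0 : ℝ) < cmax := Nat.cast_pos.mpr (by omega)
  have hcm' : (cmax : ℝ) ≤ m := by exact_mod_cast hcm
  have hlam0 : 0 < t * (1 - t) * (cmax : ℝ) / m := div_pos (mul_pos (mul_pos ht0 (by linarith)) hcpos) hmpos
  have hlam1 : t * (1 - t) * (cmax : ℝ) / m < 1 := by
    rw [div_lt_one hmpos]
    have h1 : t * (1 - t) < 1 := by nlinarith
    have h2 : 0 < t * (1 - t) := mul_pos ht0 (by linarith)
    nlinarith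
  have h := mixingTime_ge_of_geom_floor hPst hst hlam0 hlam1
    (fun n => flowStar_unitSurvival_worstTvDist_ge κ φ hK hm ht0.le ht1.le hμ hμ01 hM hperf hc hcm s n) hmix
  have e : (m : ℝ) / (t * (1 - t) * cmax) - 1 = 1 / (t * (1 - t) * (cmax : ℝ) / m) - 1 := by rw [one_div_div]
  rw [e]
  exact h

/-- **A LARGE CONFIGURATION SPACE SUPPLIES THE RARE VALUE (`|S| ≥ 4(K+1)`):
`t_mix(1/4) ≥ (m/(t(1−t)ĉ) − 1)·log 2`** for the perfectly transported flow hub. [ours] -/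
theorem flowStar_unitSurvival_mixingTime_ge_quarter_of_card (hK : 1 ≤ K) (hS : 4 * (K + 1) ≤ Fintype.card S)
    (hm : 1 ≤ m) (ht0 : 0 < t) (ht1 : t < 1) (hμ : ∀ k x, 0 < μ k x) (hμ01 : ∑ v, μ 0 v = 1)
    (hM : ∀ k, IsRowStochastic (M k)) (hMrev : ∀ k, DetailedBalance (μ k) (M k))
    (hperf : ∀ (k : Fin K) (u : S), μ k.succ (φ k u) = μ 0 u) {cmax : ℕ} (hc1 : 1 ≤ cmax)
    (hc : ∀ p' : Fin K, (univ.filter (fun r : Fin m => κ r = p')).card ≤ cmax) (hcm : cmax ≤ m)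
    (hmix : ∃ t₀, worstTvDist (fun y z : Fin (K + 1) → S =>
          t * ptGraphSwap μ (fun r : Fin m => ((0 : Fin (K + 1)), (κ r).succ)) (fun r => φ (κ r)) y z
          + (1 - t) * prodKernel (fun k : Fin (K + 1) => if k = 0 then (1 : ℝ) else 0) M y z) (tensorFun μ) t₀ ≤ 1 / 4) :
    ((m : ℝ) / (t * (1 - t) * cmax) - 1) * Real.log 2
      ≤ (mixingTime (fun y z : Fin (K + 1) → S =>
          t * ptGraphSwap μ (fun r : Fin m => ((0 : Fin (K + 1)), (κ r).succ)) (fun r => φ (κ r)) y z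
          + (1 - t) * prodKernel (fun k : Fin (K + 1) => if k = 0 then (1 : ℝ) else 0) M y z) (tensorFun μ) (1 / 4) : ℝ) := by
  have hSpos : 0 < Fintype.card S := by omega
  haveI : Nonempty S := Fintype.card_pos_iff.mp hSpos
  obtain ⟨s, hs⟩ := exists_rare_state (μ := fun _ : Fin (K + 1) => μ 0) (fun _ => hμ01)
  have hcard : (0 : ℝ) < Fintype.card S := Nat.cast_pos.mpr hSpos
  have hS' : 4 * ((K : ℝ) + 1) ≤ Fintype.card S := by exact_mod_cast hS
  have hsum : ∑ _k : Fin (K + 1), μ 0 s = ((K : ℝ) + 1) * μ 0 s := by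
    simp only [sum_const, card_univ, Fintype.card_fin, nsmul_eq_mul, Nat.cast_add, Nat.cast_one]
  rw [hsum] at hs
  have hδ : ((K : ℝ) + 1) * μ 0 s ≤ 1 / 4 := hs.trans (by rw [div_le_iff₀ hcard]; linarith)
  have h := flowStar_unitSurvival_mixingTime_ge κ φ hK hm ht0 ht1 hμ hμ01 hM hMrev hperf hc1 hc hcm s (ε := 1 / 4) hmix
  refine le_trans ?_ h
  have hmpos : (0 : ℝ) < m := Nat.cast_pos.mpr (by omega)
  have hcpos : (0 : ℝ) < cmax := Nat.cast_pos.mpr (by omega)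
  have hcm' : (cmax : ℝ) ≤ m := by exact_mod_cast hcm
  have hcoef : 0 ≤ (m : ℝ) / (t * (1 - t) * cmax) - 1 := by
    rw [sub_nonneg, le_div_iff₀ (mul_pos (mul_pos ht0 (by linarith)) hcpos)]
    have h1 : t * (1 - t) ≤ 1 := by nlinarith
    have h2 : 0 < t * (1 - t) := mul_pos ht0 (by linarith)
    nlinarith
  refine mul_le_mul_of_nonneg_left ?_ hcoef
  have hνs : 0 < μ 0 s := hμ 0 s
  have hKν : 0 ≤ ((K : ℝ) + 1) * μ 0 s := mul_nonneg (by positivity) hνs.le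
  refine Real.log_le_log (by norm_num) ?_
  rw [le_div_iff₀ (by linarith)]
  linarith

/-- **UNIFORM LISTING (`m = cK`, every multiplicity `≤ c`): `t_mix(1/4) ≥ (K/(t(1−t)) − 1)·log 2`** for the perfectly
transported flow hub — the unit of its ceiling `⌈(2m/(t(1−t)c))·log((K+1)/(tε))⌉`, up to the logarithm. [ours] -/
theorem uniformFlowStar_unitSurvival_floor (hK : 1 ≤ K) (hS : 4 * (K + 1) ≤ Fintype.card S) (ht0 : 0 < t)
    (ht1 : t < 1) (hμ : ∀ k x, 0 < μ k x) (hμ01 : ∑ v, μ 0 v = 1) (hM : ∀ k, IsRowStochastic (M k))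
    (hMrev : ∀ k, DetailedBalance (μ k) (M k)) (hperf : ∀ (k : Fin K) (u : S), μ k.succ (φ k u) = μ 0 u)
    {c : ℕ} (hc1 : 1 ≤ c) (hc : ∀ p' : Fin K, (univ.filter (fun r : Fin m => κ r = p')).card ≤ c) (hmc : m = c * K)
    (hmix : ∃ t₀, worstTvDist (fun y z : Fin (K + 1) → S =>
          t * ptGraphSwap μ (fun r : Fin m => ((0 : Fin (K + 1)), (κ r).succ)) (fun r => φ (κ r)) y z
          + (1 - t) * prodKernel (fun k : Fin (K + 1) => if k = 0 then (1 : ℝ) else 0) M y z) (tensorFun μ) t₀ ≤ 1 / 4) :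
    ((K : ℝ) / (t * (1 - t)) - 1) * Real.log 2
      ≤ (mixingTime (fun y z : Fin (K + 1) → S =>
          t * ptGraphSwap μ (fun r : Fin m => ((0 : Fin (K + 1)), (κ r).succ)) (fun r => φ (κ r)) y z
          + (1 - t) * prodKernel (fun k : Fin (K + 1) => if k = 0 then (1 : ℝ) else 0) M y z) (tensorFun μ) (1 / 4) : ℝ) := by
  have hm : 1 ≤ m := by rw [hmc]; exact Nat.one_le_iff_ne_zero.mpr (Nat.mul_ne_zero (by omega) (by omega))
  have hcm : c ≤ m := by rw [hmc]; exact Nat.le_mul_of_pos_right c (by omega)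
  have h := flowStar_unitSurvival_mixingTime_ge_quarter_of_card κ φ hK hS hm ht0 ht1 hμ hμ01 hM hMrev hperf hc1 hc hcm
    hmix
  have hcpos : (0 : ℝ) < c := Nat.cast_pos.mpr (by omega)
  have h1t : 0 < 1 - t := by linarith
  have e : (m : ℝ) / (t * (1 - t) * c) = (K : ℝ) / (t * (1 - t)) := by
    rw [hmc, Nat.cast_mul]
    field_simp
  rwa [e] at h

end FlowFloor

end Summit.Ventures.LatticeQCDFlow.Scaling

end
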